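import Mathlib
import HarnessLib
import Summits.ValiantsHypothesis.ValiantsHypothesis.Theses.PermanentalCones
import Summits.ValiantsHypothesis.ValiantsHypothesis.Theorems.PermanentalConesHyperbolicVPShadowSymmetricCase
import Literature.AlgebraicGeometry.HyperbolicPolynomials.SpectrahedralShadowCalculus

/-!
# ValiantsHypothesis / PermanentalCones — `HyperbolicVPShadow`, stub B: normal-form toolkit and the
# block-symmetrisable case

Route `PermanentalCones`, item `stmt-ValiantsHypothesis-8655` (crux `HyperbolicVPShadow`), line
`birth`, stub `stub_realSpectrumShadow` (stub B): for a linear pencil `P : ℝⁿ →ₗ Mat_N(ℝ)` all of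
whose values have only real eigenvalues, the closed "nonnegative spectrum" cone
`{x : ∀ τ > 0, det (P x + τ·1) ≠ 0}` should be a lifted-LMI set (spectrahedral shadow) of
quasi-polynomial size. Stub B is crux #3 `HyperbolicDetShadow` in normal form (landed bridges) and
contains the Netzer–Sanyal conjecture; this file lands the provable layer of the route's two-layer
plan ("RealSpectrumNormalForm → BlockSymmetrisable case → general"):

* `permanentalCones_nonnegSpectrum_conj_iff`, `permanentalCones_realSpectrum_conj_iff` — the cone
  condition and the real-spectrum hypothesis are invariant under a fixed similarity
  `X ↦ S X S⁻¹` (change of basis is free);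
* `permanentalCones_nonnegSpectrum_fromBlocks_iff`, `permanentalCones_realSpectrum_fromBlocks_iff`
  — for a block upper-triangular matrix both conditions split over the diagonal blocks (the
  off-diagonal block is invisible), so the cone of a block-triangular pencil is the INTERSECTION
  of the cones of its diagonal blocks;
* `permanentalCones_isSpectrahedralShadowOfSize_of_rep`,
  `permanentalCones_isSpectrahedralShadowOfSize_inter` — sized bookkeeping: a presentation with
  any finite index type `ι` has size `card ι`, and sizes ADD under intersection
  (`m₁ + m₂`, block-diagonal LMI);
* `permanentalCones_nonnegSpectrum_iff_posSemidef_symmetrizer` — SYMMETRISABLE matrices: if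
  `S ≻ 0` and `S X` is symmetric then `X` has no negative eigenvalue iff `S X ⪰ 0`
  (via `√S`: `√S X √S⁻¹ = √S⁻¹ (S X) √S⁻¹` is symmetric and congruent to `S X`);
  hence the cone of a symmetrisable pencil is the spectrahedron `{x : S · P x ⪰ 0}` of size `N`
  (`permanentalCones_realSpectrumShadow_symmetrizable`), generalising the symmetric case
  (`…SymmetricCase.lean`, `S = 1`);
* `permanentalCones_nonnegSpectrum_iff_diag_nonneg_of_upperTriangular` — TRIANGULARISABLE
  matrices: an upper-triangular `X` has no negative eigenvalue iff its diagonal is `≥ 0`; the cone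
  of an upper-triangular pencil is polyhedral, an LMI of size `N` with a diagonal matrix
  (`permanentalCones_realSpectrumShadow_upperTriangular`);
* `permanentalCones_realSpectrumShadow_blockSymmetrizable` — the BLOCK-SYMMETRISABLE case of
  stub B: a pencil which, after one similarity, is block upper-triangular with two symmetrisable
  diagonal blocks of sizes `N₁, N₂` has a cone that is a lifted-LMI set of size `N₁ + N₂` (= `N`,
  no growth). Iterating over a composition series of invariant subspaces, stub B for a pencil
  reduces to stub B for the IRREDUCIBLE diagonal blocks of its block-triangularisation, at no
  cost in size — the open core of stub B / crux #3 is the irreducible non-symmetrisable block.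

All statements are folklore linear algebra; no named facts, no complexity theory.
-/

-- `<Problem> = <Summit>` for this single-conjunct summit (lakefile sets the same option tree-wide).
set_option linter.dupNamespace false

noncomputable section

namespace Summit.ValiantsHypothesis.ValiantsHypothesis.Theorems

open Matrix
open scoped MatrixOrder
open Literature.AlgebraicGeometry.HyperbolicPolynomials

/-! ### Similarity invariance -/

/-- The closed "no negative eigenvalue" condition `∀ τ > 0, det (X + τ·1) ≠ 0` is invariant under
similarity `X ↦ S X S⁻¹`. [folklore] -/
theorem permanentalCones_nonnegSpectrum_conj_iff {m : Type*} [Fintype m] [DecidableEq m]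
    {S : Matrix m m ℝ} (hS : IsUnit S) (X : Matrix m m ℝ) :
    (∀ τ : ℝ, 0 < τ → (S * X * S⁻¹ + τ • (1 : Matrix m m ℝ)).det ≠ 0) ↔
      ∀ τ : ℝ, 0 < τ → (X + τ • (1 : Matrix m m ℝ)).det ≠ 0 := by
  have hSdet : IsUnit S.det := (Matrix.isUnit_iff_isUnit_det S).1 hS
  refine forall_congr' fun τ => imp_congr_right fun _ => ?_
  rw [show S * X * S⁻¹ + τ • (1 : Matrix m m ℝ) = S * (X + τ • (1 : Matrix m m ℝ)) * S⁻¹ by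
    rw [Matrix.mul_add, Matrix.add_mul, Matrix.mul_smul, Matrix.mul_one, Matrix.smul_mul,
      Matrix.mul_nonsing_inv S hSdet], Matrix.det_conj hS]

/-- The real-spectrum condition "every complex eigenvalue of `X` is real" is invariant under a
real similarity `X ↦ S X S⁻¹`. [folklore] -/
theorem permanentalCones_realSpectrum_conj_iff {m : Type*} [Fintype m] [DecidableEq m]
    {S : Matrix m m ℝ} (hS : IsUnit S) (X : Matrix m m ℝ) :
    (∀ z : ℂ, ((S * X * S⁻¹).map (algebraMap ℝ ℂ) - z • (1 : Matrix m m ℂ)).det = 0 → z.im = 0) ↔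
      ∀ z : ℂ, (X.map (algebraMap ℝ ℂ) - z • (1 : Matrix m m ℂ)).det = 0 → z.im = 0 := by
  have hSdet : IsUnit S.det := (Matrix.isUnit_iff_isUnit_det S).1 hS
  have h1 : S.map (algebraMap ℝ ℂ) * S⁻¹.map (algebraMap ℝ ℂ) = 1 := by
    rw [← Matrix.map_mul, Matrix.mul_nonsing_inv S hSdet,
      Matrix.map_one _ (map_zero _) (map_one _)]
  have h2 : S⁻¹.map (algebraMap ℝ ℂ) * S.map (algebraMap ℝ ℂ) = 1 := by
    rw [← Matrix.map_mul, Matrix.nonsing_inv_mul S hSdet,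
      Matrix.map_one _ (map_zero _) (map_one _)]
  refine forall_congr' fun z => ?_
  rw [show (S * X * S⁻¹).map (algebraMap ℝ ℂ) - z • (1 : Matrix m m ℂ) =
      S.map (algebraMap ℝ ℂ) * (X.map (algebraMap ℝ ℂ) - z • (1 : Matrix m m ℂ)) *
        S⁻¹.map (algebraMap ℝ ℂ) by
    rw [Matrix.mul_sub, Matrix.sub_mul, Matrix.mul_smul, Matrix.mul_one, Matrix.smul_mul, h1,
      Matrix.map_mul, Matrix.map_mul], Matrix.det_conj_of_mul_eq_one h1 h2]

/-! ### Block upper-triangular matrices: both conditions split over the diagonal blocks -/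

/-- For a block upper-triangular real matrix, "no negative eigenvalue" holds iff it holds for both
diagonal blocks (the off-diagonal block is invisible). [folklore] -/
theorem permanentalCones_nonnegSpectrum_fromBlocks_iff {m₁ m₂ : Type*} [Fintype m₁] [Fintype m₂]
    [DecidableEq m₁] [DecidableEq m₂] (X₁ : Matrix m₁ m₁ ℝ) (Y : Matrix m₁ m₂ ℝ)
    (X₂ : Matrix m₂ m₂ ℝ) :
    (∀ τ : ℝ, 0 < τ →
        (fromBlocks X₁ Y 0 X₂ + τ • (1 : Matrix (m₁ ⊕ m₂) (m₁ ⊕ m₂) ℝ)).det ≠ 0) ↔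
      (∀ τ : ℝ, 0 < τ → (X₁ + τ • (1 : Matrix m₁ m₁ ℝ)).det ≠ 0) ∧
        ∀ τ : ℝ, 0 < τ → (X₂ + τ • (1 : Matrix m₂ m₂ ℝ)).det ≠ 0 := by
  have key : ∀ τ : ℝ, fromBlocks X₁ Y 0 X₂ + τ • (1 : Matrix (m₁ ⊕ m₂) (m₁ ⊕ m₂) ℝ) =
      fromBlocks (X₁ + τ • (1 : Matrix m₁ m₁ ℝ)) Y 0 (X₂ + τ • (1 : Matrix m₂ m₂ ℝ)) := by
    intro τ
    rw [← fromBlocks_one, fromBlocks_smul, fromBlocks_add]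
    simp only [smul_zero, add_zero]
  simp_rw [key, det_fromBlocks_zero₂₁, mul_ne_zero_iff, imp_and, forall_and]

/-- For a block upper-triangular real matrix, "only real eigenvalues" holds iff it holds for both
diagonal blocks. [folklore] -/
theorem permanentalCones_realSpectrum_fromBlocks_iff {m₁ m₂ : Type*} [Fintype m₁] [Fintype m₂]
    [DecidableEq m₁] [DecidableEq m₂] (X₁ : Matrix m₁ m₁ ℝ) (Y : Matrix m₁ m₂ ℝ)
    (X₂ : Matrix m₂ m₂ ℝ) :
    (∀ z : ℂ, ((fromBlocks X₁ Y 0 X₂).map (algebraMap ℝ ℂ) -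
        z • (1 : Matrix (m₁ ⊕ m₂) (m₁ ⊕ m₂) ℂ)).det = 0 → z.im = 0) ↔
      (∀ z : ℂ, (X₁.map (algebraMap ℝ ℂ) - z • (1 : Matrix m₁ m₁ ℂ)).det = 0 → z.im = 0) ∧
        ∀ z : ℂ, (X₂.map (algebraMap ℝ ℂ) - z • (1 : Matrix m₂ m₂ ℂ)).det = 0 → z.im = 0 := by
  have key : ∀ z : ℂ, (fromBlocks X₁ Y 0 X₂).map (algebraMap ℝ ℂ) -
      z • (1 : Matrix (m₁ ⊕ m₂) (m₁ ⊕ m₂) ℂ) =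
      fromBlocks (X₁.map (algebraMap ℝ ℂ) - z • (1 : Matrix m₁ m₁ ℂ)) (Y.map (algebraMap ℝ ℂ)) 0
        (X₂.map (algebraMap ℝ ℂ) - z • (1 : Matrix m₂ m₂ ℂ)) := by
    intro z
    rw [fromBlocks_map, Matrix.map_zero _ (map_zero _), ← fromBlocks_one, fromBlocks_smul,
      sub_eq_add_neg, fromBlocks_neg, fromBlocks_add]
    simp only [smul_zero, neg_zero, add_zero, ← sub_eq_add_neg]
  simp_rw [key, det_fromBlocks_zero₂₁, mul_eq_zero, or_imp, forall_and]

/-! ### Sized bookkeeping for lifted-LMI sets -/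

/-- A lifted-LMI presentation with an arbitrary finite index type `ι` and an arbitrary
finite-dimensional lifting space is a presentation of size `card ι` (reindex, choose
coordinates). Sized form of `isSpectrahedralShadow_of_rep`. [folklore] -/
theorem permanentalCones_isSpectrahedralShadowOfSize_of_rep {σ ι V : Type*} [Fintype ι]
    [AddCommGroup V] [Module ℝ V] [Module.Finite ℝ V] {K : Set (σ → ℝ)}
    (A : ((σ → ℝ) × V) →ₗ[ℝ] Matrix ι ι ℝ) (B : Matrix ι ι ℝ)
    (h : ∀ x, x ∈ K ↔ ∃ y : V, (A (x, y) + B).PosSemidef) :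
    IsSpectrahedralShadowOfSize K (Fintype.card ι) := by
  classical
  set eι := Fintype.equivFin ι with heι
  set eV : V ≃ₗ[ℝ] (Fin (Module.finrank ℝ V) → ℝ) := (Module.finBasis ℝ V).equivFun with heV
  refine ⟨Module.finrank ℝ V,
    (Matrix.reindexLinearEquiv ℝ ℝ eι eι).toLinearMap ∘ₗ A ∘ₗ
      (LinearMap.id.prodMap eV.symm.toLinearMap), Matrix.reindex eι eι B, fun x => ?_⟩
  rw [h]
  have key : ∀ y : V, ((Matrix.reindexLinearEquiv ℝ ℝ eι eι).toLinearMap ∘ₗ A ∘ₗ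
      (LinearMap.id.prodMap eV.symm.toLinearMap)) (x, eV y) + Matrix.reindex eι eι B =
      (A (x, y) + B).submatrix eι.symm eι.symm := by
    intro y
    simp [Matrix.reindex_apply, Matrix.submatrix_add]
  constructor
  · rintro ⟨y, hy⟩
    exact ⟨eV y, by rw [key]; exact (posSemidef_submatrix_equiv eι.symm).2 hy⟩
  · rintro ⟨y', hy'⟩
    refine ⟨eV.symm y', ?_⟩
    have := key (eV.symm y')
    rw [LinearEquiv.apply_symm_apply] at this
    rw [this] at hy'
    exact (posSemidef_submatrix_equiv eι.symm).1 hy'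

/-- **Sizes add under intersection**: if `K₁, K₂ ⊆ ℝ^σ` have lifted-LMI presentations of sizes
`m₁, m₂`, then `K₁ ∩ K₂` has one of size `m₁ + m₂` (block-diagonal LMI, lifting variables
concatenated). [folklore] -/
theorem permanentalCones_isSpectrahedralShadowOfSize_inter {σ : Type*} {K₁ K₂ : Set (σ → ℝ)}
    {m₁ m₂ : ℕ} (h₁ : IsSpectrahedralShadowOfSize K₁ m₁) (h₂ : IsSpectrahedralShadowOfSize K₂ m₂) :
    IsSpectrahedralShadowOfSize (K₁ ∩ K₂) (m₁ + m₂) := by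
  obtain ⟨p₁, A₁, B₁, h₁⟩ := h₁
  obtain ⟨p₂, A₂, B₂, h₂⟩ := h₂
  let π₁ : ((σ → ℝ) × ((Fin p₁ → ℝ) × (Fin p₂ → ℝ))) →ₗ[ℝ] ((σ → ℝ) × (Fin p₁ → ℝ)) :=
    LinearMap.id.prodMap (LinearMap.fst ℝ _ _)
  let π₂ : ((σ → ℝ) × ((Fin p₁ → ℝ) × (Fin p₂ → ℝ))) →ₗ[ℝ] ((σ → ℝ) × (Fin p₂ → ℝ)) :=
    LinearMap.id.prodMap (LinearMap.snd ℝ _ _)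
  have hrep := permanentalCones_isSpectrahedralShadowOfSize_of_rep (K := K₁ ∩ K₂)
    (blockDiagLin (A₁ ∘ₗ π₁) (A₂ ∘ₗ π₂)) (fromBlocks B₁ 0 0 B₂) (fun x => by
      simp only [Set.mem_inter_iff, h₁, h₂, blockDiagLin_apply, LinearMap.comp_apply,
        fromBlocks_add, add_zero, posSemidef_fromBlocks_zero_iff]
      constructor
      · rintro ⟨⟨y₁, hy₁⟩, ⟨y₂, hy₂⟩⟩
        exact ⟨(y₁, y₂), by simpa [π₁] using hy₁, by simpa [π₂] using hy₂⟩
      · rintro ⟨y, hy₁, hy₂⟩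
        exact ⟨⟨y.1, by simpa [π₁] using hy₁⟩, ⟨y.2, by simpa [π₂] using hy₂⟩⟩)
  simpa only [Fintype.card_sum, Fintype.card_fin] using hrep

/-! ### Symmetrisable matrices and pencils -/

/-- **Symmetrisable matrices.** If `S` is positive definite and `S X` is symmetric (i.e. `X` is
self-adjoint for the inner product `⟨u, v⟩_S = uᵀ S v`), then `X` has no negative eigenvalue —
`det (X + τ·1) ≠ 0` for all `τ > 0` — iff `S X ⪰ 0`. Proof: with `R = √S`,
`R X R⁻¹ = R⁻¹ (S X) R⁻¹` is symmetric, similar to `X` and congruent to `S X`. [folklore] -/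
theorem permanentalCones_nonnegSpectrum_iff_posSemidef_symmetrizer {m : Type*} [Fintype m]
    [DecidableEq m] {S X : Matrix m m ℝ} (hS : S.PosDef) (hSX : (S * X).IsSymm) :
    (∀ τ : ℝ, 0 < τ → (X + τ • (1 : Matrix m m ℝ)).det ≠ 0) ↔ (S * X).PosSemidef := by
  -- the positive square root `R` of `S`
  set R : Matrix m m ℝ := CFC.sqrt S with hR
  have hRR : R * R = S := CFC.sqrt_mul_sqrt_self S hS.posSemidef.nonneg
  have hRu : IsUnit R := (CFC.isUnit_sqrt_iff S hS.posSemidef.nonneg).2 hS.isUnit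
  have hRdet : IsUnit R.det := (Matrix.isUnit_iff_isUnit_det R).1 hRu
  have hRh : Rᴴ = R := (CFC.sqrt_nonneg S).isSelfAdjoint
  have hRt : Rᵀ = R := by rwa [Matrix.conjTranspose_eq_transpose_of_trivial] at hRh
  have hRiu : IsUnit R⁻¹ := Matrix.isUnit_nonsing_inv_iff.2 hRu
  -- `R X R⁻¹ = R⁻¹ (S X) R⁻¹`
  have hconj : R * X * R⁻¹ = R⁻¹ * (S * X) * R⁻¹ := by
    rw [← hRR]
    simp only [Matrix.mul_assoc]
    rw [← Matrix.mul_assoc R⁻¹ R, Matrix.nonsing_inv_mul R hRdet, Matrix.one_mul]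
  -- it is symmetric
  have hsymm : (R * X * R⁻¹).IsSymm := by
    rw [hconj]
    unfold Matrix.IsSymm
    rw [Matrix.transpose_mul, Matrix.transpose_mul, Matrix.transpose_nonsing_inv, hRt, hSX.eq]
    simp only [Matrix.mul_assoc]
  -- similar to `X`, congruent to `S X`
  rw [← permanentalCones_nonnegSpectrum_conj_iff hRu X,
    permanentalCones_forall_det_add_smul_one_ne_zero_iff hsymm, hconj]
  have hstar : star R⁻¹ = R⁻¹ := by
    rw [Matrix.star_eq_conjTranspose, Matrix.conjTranspose_nonsing_inv, hRh]
  have := Matrix.IsUnit.posSemidef_star_left_conjugate_iff (x := S * X) hRiu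
  rwa [hstar] at this

/-- **Symmetrisable case of stub B.** If a linear pencil `P` of real `N × N` matrices admits a
common symmetriser `S ≻ 0` (`S · P x` symmetric for all `x`), then every `P x` has only real
eigenvalues and the closed nonnegative-spectrum cone `{x : ∀ τ > 0, det (P x + τ·1) ≠ 0}` is the
spectrahedron `{x : S · P x ⪰ 0}`: a lifted-LMI set of size `N` with no lifting variables.
[folklore] -/
theorem permanentalCones_realSpectrumShadow_symmetrizable (n N : ℕ)
    (P : (Fin n → ℝ) →ₗ[ℝ] Matrix (Fin N) (Fin N) ℝ) (S : Matrix (Fin N) (Fin N) ℝ)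
    (hS : S.PosDef) (hSP : ∀ x : Fin n → ℝ, (S * P x).IsSymm) :
    IsSpectrahedralShadowOfSize
      {x : Fin n → ℝ | ∀ τ : ℝ, 0 < τ → (P x + τ • (1 : Matrix (Fin N) (Fin N) ℝ)).det ≠ 0} N := by
  -- the LMI `x ↦ S · P x` (size `N`, lifting space `ℝ⁰`)
  refine ⟨0, LinearMap.mulLeft ℝ S ∘ₗ P ∘ₗ LinearMap.fst ℝ (Fin n → ℝ) (Fin 0 → ℝ), 0, fun x => ?_⟩
  rw [Set.mem_setOf_eq, permanentalCones_nonnegSpectrum_iff_posSemidef_symmetrizer hS (hSP x)]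
  simp

/-! ### Triangularisable matrices and pencils -/

/-- **Upper-triangular matrices.** An upper-triangular real matrix has no negative eigenvalue iff
its diagonal entries are nonnegative. [folklore] -/
theorem permanentalCones_nonnegSpectrum_iff_diag_nonneg_of_upperTriangular {N : ℕ}
    {X : Matrix (Fin N) (Fin N) ℝ} (hX : X.BlockTriangular id) :
    (∀ τ : ℝ, 0 < τ → (X + τ • (1 : Matrix (Fin N) (Fin N) ℝ)).det ≠ 0) ↔ ∀ i, 0 ≤ X i i := by
  have hdet : ∀ τ : ℝ, (X + τ • (1 : Matrix (Fin N) (Fin N) ℝ)).det = ∏ i, (X i i + τ) := by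
    intro τ
    have hT : (X + τ • (1 : Matrix (Fin N) (Fin N) ℝ)).BlockTriangular id := by
      rw [Matrix.smul_one_eq_diagonal]
      exact hX.add (Matrix.blockTriangular_diagonal _)
    rw [Matrix.det_of_upperTriangular hT]
    refine Finset.prod_congr rfl fun i _ => ?_
    simp [Matrix.smul_one_eq_diagonal]
  simp_rw [hdet]
  constructor
  · intro h i
    by_contra hi
    refine h (-X i i) (by linarith [lt_of_not_ge hi]) ?_
    exact Finset.prod_eq_zero (Finset.mem_univ i) (by ring)
  · intro h τ hτ
    exact Finset.prod_ne_zero_iff.2 fun i _ => by linarith [h i]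

/-- **Triangular case of stub B.** If every value of a linear pencil `P` of real `N × N` matrices
is upper triangular, its closed nonnegative-spectrum cone is the polyhedral cone
`{x : (P x)ᵢᵢ ≥ 0 ∀ i}`, a lifted-LMI set of size `N` (diagonal LMI, no lifting variables).
[folklore] -/
theorem permanentalCones_realSpectrumShadow_upperTriangular (n N : ℕ)
    (P : (Fin n → ℝ) →ₗ[ℝ] Matrix (Fin N) (Fin N) ℝ)
    (hP : ∀ x : Fin n → ℝ, (P x).BlockTriangular id) :
    IsSpectrahedralShadowOfSize
      {x : Fin n → ℝ | ∀ τ : ℝ, 0 < τ → (P x + τ • (1 : Matrix (Fin N) (Fin N) ℝ)).det ≠ 0} N := by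
  -- the diagonal LMI `x ↦ diagonal (i ↦ (P x) i i)` (size `N`, lifting space `ℝ⁰`)
  refine ⟨0, Matrix.diagonalLinearMap (Fin N) ℝ ℝ ∘ₗ Matrix.diagLinearMap (Fin N) ℝ ℝ ∘ₗ P ∘ₗ
    LinearMap.fst ℝ (Fin n → ℝ) (Fin 0 → ℝ), 0, fun x => ?_⟩
  rw [Set.mem_setOf_eq, permanentalCones_nonnegSpectrum_iff_diag_nonneg_of_upperTriangular (hP x)]
  simp [Matrix.posSemidef_diagonal_iff, Matrix.diag]

/-! ### Block-triangular pencils: the cone is the intersection of the diagonal blocks' cones -/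

/-- **Block-triangular reduction of stub B.** Let `P` be a linear pencil of real `N × N` matrices
which, after a fixed similarity `S` and a reindexing `e : Fin N₁ ⊕ Fin N₂ ≃ Fin N`, is block upper
triangular with diagonal pencils `P₁` (`N₁ × N₁`) and `P₂` (`N₂ × N₂`). If the closed
nonnegative-spectrum cones of `P₁` and `P₂` are lifted-LMI sets of sizes `m₁` and `m₂`, then the
cone of `P` is a lifted-LMI set of size `m₁ + m₂`. [folklore] -/
theorem permanentalCones_realSpectrumShadow_blockTriangular (n N N₁ N₂ : ℕ)
    (P : (Fin n → ℝ) →ₗ[ℝ] Matrix (Fin N) (Fin N) ℝ)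
    (P₁ : (Fin n → ℝ) →ₗ[ℝ] Matrix (Fin N₁) (Fin N₁) ℝ)
    (P₂ : (Fin n → ℝ) →ₗ[ℝ] Matrix (Fin N₂) (Fin N₂) ℝ)
    (Q : (Fin n → ℝ) → Matrix (Fin N₁) (Fin N₂) ℝ)
    (S : Matrix (Fin N) (Fin N) ℝ) (hS : IsUnit S) (e : Fin N₁ ⊕ Fin N₂ ≃ Fin N)
    (hP : ∀ x : Fin n → ℝ,
      P x = S * Matrix.reindex e e (fromBlocks (P₁ x) (Q x) 0 (P₂ x)) * S⁻¹)
    {m₁ m₂ : ℕ}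
    (h₁ : IsSpectrahedralShadowOfSize
      {x : Fin n → ℝ | ∀ τ : ℝ, 0 < τ → (P₁ x + τ • (1 : Matrix (Fin N₁) (Fin N₁) ℝ)).det ≠ 0} m₁)
    (h₂ : IsSpectrahedralShadowOfSize
      {x : Fin n → ℝ | ∀ τ : ℝ, 0 < τ → (P₂ x + τ • (1 : Matrix (Fin N₂) (Fin N₂) ℝ)).det ≠ 0} m₂) :
    IsSpectrahedralShadowOfSize
      {x : Fin n → ℝ | ∀ τ : ℝ, 0 < τ → (P x + τ • (1 : Matrix (Fin N) (Fin N) ℝ)).det ≠ 0}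
      (m₁ + m₂) := by
  have hset : {x : Fin n → ℝ | ∀ τ : ℝ, 0 < τ → (P x + τ • (1 : Matrix (Fin N) (Fin N) ℝ)).det ≠ 0} =
      {x : Fin n → ℝ | ∀ τ : ℝ, 0 < τ → (P₁ x + τ • (1 : Matrix (Fin N₁) (Fin N₁) ℝ)).det ≠ 0} ∩
      {x : Fin n → ℝ | ∀ τ : ℝ, 0 < τ → (P₂ x + τ • (1 : Matrix (Fin N₂) (Fin N₂) ℝ)).det ≠ 0} := by
    ext x
    simp only [Set.mem_setOf_eq, Set.mem_inter_iff]
    rw [hP x, permanentalCones_nonnegSpectrum_conj_iff hS,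
      ← permanentalCones_nonnegSpectrum_fromBlocks_iff (P₁ x) (Q x) (P₂ x)]
    refine forall_congr' fun τ => imp_congr_right fun _ => ?_
    rw [show Matrix.reindex e e (fromBlocks (P₁ x) (Q x) 0 (P₂ x)) +
        τ • (1 : Matrix (Fin N) (Fin N) ℝ) =
        Matrix.reindex e e (fromBlocks (P₁ x) (Q x) 0 (P₂ x) +
          τ • (1 : Matrix (Fin N₁ ⊕ Fin N₂) (Fin N₁ ⊕ Fin N₂) ℝ)) by
      simp only [Matrix.reindex_apply, Matrix.submatrix_add, Matrix.submatrix_smul, Pi.add_apply,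
        Pi.smul_apply, Matrix.submatrix_one_equiv], Matrix.det_reindex_self]
  rw [hset]
  exact permanentalCones_isSpectrahedralShadowOfSize_inter h₁ h₂

/-- The real-spectrum hypothesis of stub B for a block-triangular pencil (as in
`permanentalCones_realSpectrumShadow_blockTriangular`) is equivalent to the real-spectrum
hypothesis for its two diagonal pencils — so the reduction loses nothing. [folklore] -/
theorem permanentalCones_realSpectrum_blockTriangular_iff (n N N₁ N₂ : ℕ)
    (P : (Fin n → ℝ) →ₗ[ℝ] Matrix (Fin N) (Fin N) ℝ)
    (P₁ : (Fin n → ℝ) →ₗ[ℝ] Matrix (Fin N₁) (Fin N₁) ℝ)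
    (P₂ : (Fin n → ℝ) →ₗ[ℝ] Matrix (Fin N₂) (Fin N₂) ℝ)
    (Q : (Fin n → ℝ) → Matrix (Fin N₁) (Fin N₂) ℝ)
    (S : Matrix (Fin N) (Fin N) ℝ) (hS : IsUnit S) (e : Fin N₁ ⊕ Fin N₂ ≃ Fin N)
    (hP : ∀ x : Fin n → ℝ,
      P x = S * Matrix.reindex e e (fromBlocks (P₁ x) (Q x) 0 (P₂ x)) * S⁻¹) :
    (∀ (x : Fin n → ℝ) (z : ℂ),
        ((P x).map (algebraMap ℝ ℂ) - z • (1 : Matrix (Fin N) (Fin N) ℂ)).det = 0 → z.im = 0) ↔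
      (∀ (x : Fin n → ℝ) (z : ℂ),
        ((P₁ x).map (algebraMap ℝ ℂ) - z • (1 : Matrix (Fin N₁) (Fin N₁) ℂ)).det = 0 → z.im = 0) ∧
      ∀ (x : Fin n → ℝ) (z : ℂ),
        ((P₂ x).map (algebraMap ℝ ℂ) - z • (1 : Matrix (Fin N₂) (Fin N₂) ℂ)).det = 0 → z.im = 0 := by
  rw [← forall_and]
  refine forall_congr' fun x => ?_
  rw [hP x, permanentalCones_realSpectrum_conj_iff hS,
    ← permanentalCones_realSpectrum_fromBlocks_iff (P₁ x) (Q x) (P₂ x)]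
  refine forall_congr' fun z => ?_
  rw [show (Matrix.reindex e e (fromBlocks (P₁ x) (Q x) 0 (P₂ x))).map (algebraMap ℝ ℂ) -
      z • (1 : Matrix (Fin N) (Fin N) ℂ) =
      Matrix.reindex e e ((fromBlocks (P₁ x) (Q x) 0 (P₂ x)).map (algebraMap ℝ ℂ) -
        z • (1 : Matrix (Fin N₁ ⊕ Fin N₂) (Fin N₁ ⊕ Fin N₂) ℂ)) by
    simp only [Matrix.reindex_apply, Matrix.submatrix_map, Matrix.submatrix_sub,
      Matrix.submatrix_smul, Pi.sub_apply, Pi.smul_apply, Matrix.submatrix_one_equiv],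
      Matrix.det_reindex_self]

/-- **Block-symmetrisable case of stub B** (the route's "BlockSymmetrisable" layer). A linear pencil
of real `N × N` matrices which, after one similarity, is block upper triangular with two
diagonal pencils admitting positive definite symmetrisers `S₁`, `S₂` has a closed
nonnegative-spectrum cone that is a lifted-LMI set of size `N₁ + N₂` — no growth in size.
(By `permanentalCones_realSpectrum_blockTriangular_iff` such pencils automatically have only real
eigenvalues.) The open core of stub B is thus the irreducible, non-symmetrisable block. [folklore] -/
theorem permanentalCones_realSpectrumShadow_blockSymmetrizable :
    ∀ (n N N₁ N₂ : ℕ) (P : (Fin n → ℝ) →ₗ[ℝ] Matrix (Fin N) (Fin N) ℝ)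
      (P₁ : (Fin n → ℝ) →ₗ[ℝ] Matrix (Fin N₁) (Fin N₁) ℝ)
      (P₂ : (Fin n → ℝ) →ₗ[ℝ] Matrix (Fin N₂) (Fin N₂) ℝ)
      (Q : (Fin n → ℝ) → Matrix (Fin N₁) (Fin N₂) ℝ) (S : Matrix (Fin N) (Fin N) ℝ)
      (e : Fin N₁ ⊕ Fin N₂ ≃ Fin N) (S₁ : Matrix (Fin N₁) (Fin N₁) ℝ)
      (S₂ : Matrix (Fin N₂) (Fin N₂) ℝ), IsUnit S →
      (∀ x : Fin n → ℝ,
        P x = S * Matrix.reindex e e (Matrix.fromBlocks (P₁ x) (Q x) 0 (P₂ x)) * S⁻¹) →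
      S₁.PosDef → (∀ x : Fin n → ℝ, (S₁ * P₁ x).IsSymm) →
      S₂.PosDef → (∀ x : Fin n → ℝ, (S₂ * P₂ x).IsSymm) →
      Literature.AlgebraicGeometry.HyperbolicPolynomials.IsSpectrahedralShadowOfSize
        {x : Fin n → ℝ | ∀ τ : ℝ, 0 < τ → (P x + τ • (1 : Matrix (Fin N) (Fin N) ℝ)).det ≠ 0}
        (N₁ + N₂) :=
  fun n N N₁ N₂ P P₁ P₂ Q S e S₁ S₂ hS hP hS₁ hSP₁ hS₂ hSP₂ =>
  permanentalCones_realSpectrumShadow_blockTriangular n N N₁ N₂ P P₁ P₂ Q S hS e hP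
    (permanentalCones_realSpectrumShadow_symmetrizable n N₁ P₁ S₁ hS₁ hSP₁)
    (permanentalCones_realSpectrumShadow_symmetrizable n N₂ P₂ S₂ hS₂ hSP₂)

end Summit.ValiantsHypothesis.ValiantsHypothesis.Theorems

end
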